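import Summits.HodgeConjecture.HodgeCM.PerL34.PureTensorChar_1

/-! PORT of `HodgeCM/PerL34/PureTensorChar.lean` (HodgeCMPerL run 82) — part 2: continuation of `Summits.HodgeConjecture.HodgeCM.PerL34.PureTensorChar_1` (split at a top-level declaration boundary by port_pkg.py; scope re-opened below; declarations unchanged). -/

-- port_pkg: scope re-opened for this part (file-level context, then the namespace/section stack open at the cut)
set_option autoImplicit false
noncomputable section
open MeasureTheory Set Filter Function Topology
open scoped RestrictedProduct
namespace HodgeCM.PerL34.PureTensor
open HodgeCM.PerL34.AdelicFactorisation HodgeCM.PerL34.RestrictedMeasure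
  HodgeCM.PerL34.NoSmallSubgroups
universe u v
section normOne

variable {α : Type*} [MeasurableSpace α] {μ : Measure α}

/-- (Ported verbatim from the HodgeCMPerL package; no docstring in the source.) -/
theorem norm_mul_coe_circle (c : ℂ) (z : Circle) : ‖c * (z : ℂ)‖ = ‖c‖ := by
  rw [norm_mul, Circle.norm_coe, mul_one]

/-- Multiplying by a measurable function of norm `≤ 1` preserves integrability. -/
theorem integrable_mul_of_norm_le_one {c u : α → ℂ} (hc : Integrable c μ)
    (hu : AEStronglyMeasurable u μ) (hu1 : ∀ x, ‖u x‖ ≤ 1) :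
    Integrable (fun x => c x * u x) μ :=
  hc.mul_bdd hu (Filter.Eventually.of_forall hu1)

end normOne

section N31

variable {ι : Type u} {G : ι → Type v} [∀ i, CommGroup (G i)] [∀ i, MeasurableSpace (G i)]
  {Sub : ι → Type*} [∀ i, SetLike (Sub i) (G i)] [∀ i, SubgroupClass (Sub i) (G i)]
  (B : ∀ i, Sub i) [Countable ι] [DecidableEq ι]
  {Sp E : Type*} [NormedAddCommGroup Sp] [InnerProductSpace ℂ Sp]
  [NormedAddCommGroup E] [InnerProductSpace ℂ E]

open scoped InnerProductSpace
open ComplexConjugate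

/-- **Seam (I) BY NAME, `χ′`-half discharged.**  pv11's `hEuler_of_pureTensor`
(`∫_{U(W_i)(𝔸)} ⟨ω(y)φ,φ⟩χ′(y)dy = ∏_v I_v`, PerL v5 ll. 608–609) with its first binder
`hf : D.IsPureTensor T (fun y => ⟪φ, ω y φ⟫ * χ′ y) fl` REPLACED by
* `hc` : the pure-tensor factorisation of the matrix coefficient `y ↦ ⟪φ, ω y φ⟫` ALONE (the
  residual DICTIONARY hypothesis: `ω = ⊗′ω_v` on `φ = ⊗φ_v`, SETUP D4/D5), and
* `hχ` : the unitary character `χ′` is trivial on a box subgroup `K_{T′}` (for a CONTINUOUS `χ′`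
  this is pv10's theorem: `exists_boxSubgroup_le_ker`; see `hEuler_of_coeffTensor_of_continuous`),
the local factors being `cl i g * χ′_i g` (`χ′_i = χ′ ∘ inclusion at i`); the local `L¹` data are
those of `cl` since `‖χ′_i‖ = 1`. -/
theorem hEuler_of_coeffTensor (D : RestrictedProductMeasureDatum ι G (Πʳ i, [G i, B i]))
    (hD : IsCoordinate D) (ω : (Πʳ i, [G i, B i]) →* (Sp ≃ₗᵢ[ℂ] Sp)) (φ : Sp)
    (χ : (Πʳ i, [G i, B i]) →* Circle) {T' : Finset ι}
    (hχ : RestrictedProduct.boxSubgroup B T' ≤ χ.ker) {T : Finset ι} {cl : ∀ i, G i → ℂ}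
    (hc : D.IsPureTensor T (fun y => inner ℂ φ (ω y φ)) cl)
    (hfm : AEStronglyMeasurable (fun y => inner ℂ φ (ω y φ) * ((χ y : Circle) : ℂ)) D.μ)
    (hcl : ∀ i, Integrable (cl i) (D.ν i))
    (hχl : ∀ i, AEStronglyMeasurable
      (fun g : G i => ((χ (RestrictedProduct.mulSingle B i g) : Circle) : ℂ)) (D.ν i))
    (hB : ∃ C : ℝ, ∀ S : Finset ι, D.S₀ ⊆ S → T ∪ T' ⊆ S → ∏ i ∈ S, ∫ x, ‖cl i x‖ ∂D.ν i ≤ C)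
    {I : ι → ℝ} (hI : ∀ i, ∫ x, cl i x * ((χ (RestrictedProduct.mulSingle B i x) : Circle) : ℂ)
      ∂D.ν i = (I i : ℂ)) :
    ∫ y, inner ℂ φ (ω y φ) * ((χ y : Circle) : ℂ) ∂D.μ = ((∏' i, I i : ℝ) : ℂ) := by
  refine RestrictedProductMeasureDatum.hEuler_of_pureTensor D ω φ (fun y => ((χ y : Circle) : ℂ))
    (hc.mul (hD.isPureTensor_unitaryChar B χ hχ)) hfm
    (fun i => integrable_mul_of_norm_le_one (hcl i) (hχl i) fun x => (Circle.norm_coe _).le) ?_ hI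
  obtain ⟨C, hC⟩ := hB
  refine ⟨C, fun S hS₀ hTS => ?_⟩
  have h := hC S hS₀ hTS
  simpa only [norm_mul_coe_circle] using h

variable [∀ i, TopologicalSpace (G i)] [∀ i, OpensMeasurableSpace (G i)]

/-- `hEuler_of_coeffTensor` for a CONTINUOUS unitary character `χ′` of `Πʳ i, [G i, B i]` (all
`B i` open): the box subgroup on which `χ′` is trivial (pv10, ll. 623–626) and the measurability of
the continuous local components are supplied; the user provides the factorisation `hc` of the
matrix coefficient, measurability of the integrand, the local `L¹` data of `cl` on all levels
`S ⊇ S₀ ∪ T`, and the local values. -/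
theorem hEuler_of_coeffTensor_of_continuous (hBopen : ∀ i, IsOpen (B i : Set (G i)))
    (D : RestrictedProductMeasureDatum ι G (Πʳ i, [G i, B i])) (hD : IsCoordinate D)
    (ω : (Πʳ i, [G i, B i]) →* (Sp ≃ₗᵢ[ℂ] Sp)) (φ : Sp)
    (χ : (Πʳ i, [G i, B i]) →* Circle) (hχ : Continuous χ) {T : Finset ι} {cl : ∀ i, G i → ℂ}
    (hc : D.IsPureTensor T (fun y => inner ℂ φ (ω y φ)) cl)
    (hfm : AEStronglyMeasurable (fun y => inner ℂ φ (ω y φ) * ((χ y : Circle) : ℂ)) D.μ)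
    (hcl : ∀ i, Integrable (cl i) (D.ν i))
    (hB : ∃ C : ℝ, ∀ S : Finset ι, D.S₀ ⊆ S → T ⊆ S → ∏ i ∈ S, ∫ x, ‖cl i x‖ ∂D.ν i ≤ C)
    {I : ι → ℝ} (hI : ∀ i, ∫ x, cl i x * ((χ (RestrictedProduct.mulSingle B i x) : Circle) : ℂ)
      ∂D.ν i = (I i : ℂ)) :
    ∫ y, inner ℂ φ (ω y φ) * ((χ y : Circle) : ℂ) ∂D.μ = ((∏' i, I i : ℝ) : ℂ) := by
  obtain ⟨T', hT'⟩ := exists_boxSubgroup_le_ker B hBopen χ hχ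
  refine hEuler_of_coeffTensor B D hD ω φ χ hT' hc hfm hcl
    (fun i => (continuous_localComponent B χ hχ i).aestronglyMeasurable) ?_ hI
  obtain ⟨C, hC⟩ := hB
  exact ⟨C, fun S hS₀ hTS => hC S hS₀ (Finset.subset_union_left.trans hTS)⟩

omit [DecidableEq ι] [∀ i, OpensMeasurableSpace (G i)] in
/-- The `hfm` binder from continuity: on `Πʳ i, [G i, B i]` with the σ-algebra of
`RestrictedMeasure` (= the Borel σ-algebra of the restricted-product topology, pv09-g2
`RestrictedMeasure.borelSpace`; countable `ι`, second-countable `G i`, measurable `B i`), the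
integrand `y ↦ ⟪φ, ω(y)φ⟫ χ′(y)` is a.e. strongly measurable for EVERY measure as soon as the orbit
map `y ↦ ω(y)φ` and `χ′` are continuous. -/
theorem aestronglyMeasurable_coeff_mul_char [∀ i, BorelSpace (G i)]
    [∀ i, SecondCountableTopology (G i)] (hBm : ∀ i, MeasurableSet (B i : Set (G i)))
    (μ : Measure (Πʳ i, [G i, B i])) (ω : (Πʳ i, [G i, B i]) →* (Sp ≃ₗᵢ[ℂ] Sp)) (φ : Sp)
    (hω : Continuous fun y => ω y φ) (χ : (Πʳ i, [G i, B i]) →* Circle) (hχ : Continuous χ) :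
    AEStronglyMeasurable (fun y => inner ℂ φ (ω y φ) * ((χ y : Circle) : ℂ)) μ := by
  haveI := RestrictedMeasure.borelSpace (fun i => (B i : Set (G i))) hBm
  exact ((continuous_const.inner hω).mul (continuous_subtype_val.comp hχ)).aestronglyMeasurable

omit [∀ i, TopologicalSpace (G i)] [∀ i, OpensMeasurableSpace (G i)] in
/-- **N31e + seam (I), `χ′`-half discharged ⇒ the `rallis` field of pv13's `LocalFactorDatum`**:
pv11's `rallis_field_of_pureTensor` with `hf` replaced by the factorisation `hc` of the matrix
coefficient and a box subgroup on which `χ′` is trivial. -/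
theorem rallis_field_of_coeffTensor (D : RestrictedProductMeasureDatum ι G (Πʳ i, [G i, B i]))
    (hD : IsCoordinate D) (ω : (Πʳ i, [G i, B i]) →* (Sp ≃ₗᵢ[ℂ] Sp)) (φ : Sp)
    (χ : (Πʳ i, [G i, B i]) →* Circle) {𝓕 : Set (Πʳ i, [G i, B i])}
    {K : (Πʳ i, [G i, B i]) → (Πʳ i, [G i, B i]) → ℂ} {c vol : ℝ} {θ : E}
    (hvol : vol = (D.μ 𝓕).toReal)
    (hN31e : RallisIP.N31e_statement D.μ 𝓕 ω φ (fun y => ((χ y : Circle) : ℂ)) K (c : ℂ))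
    (hnorm : ⟪θ, θ⟫_ℂ = ∫ u in 𝓕, ∫ u' in 𝓕, ((χ u : Circle) : ℂ) * conj ((χ u' : Circle) : ℂ) *
      K u u' ∂D.μ ∂D.μ)
    {T' : Finset ι} (hχ : RestrictedProduct.boxSubgroup B T' ≤ χ.ker)
    {T : Finset ι} {cl : ∀ i, G i → ℂ}
    (hc : D.IsPureTensor T (fun y => inner ℂ φ (ω y φ)) cl)
    (hfm : AEStronglyMeasurable (fun y => inner ℂ φ (ω y φ) * ((χ y : Circle) : ℂ)) D.μ)
    (hcl : ∀ i, Integrable (cl i) (D.ν i))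
    (hχl : ∀ i, AEStronglyMeasurable
      (fun g : G i => ((χ (RestrictedProduct.mulSingle B i g) : Circle) : ℂ)) (D.ν i))
    (hB : ∃ C : ℝ, ∀ S : Finset ι, D.S₀ ⊆ S → T ∪ T' ⊆ S → ∏ i ∈ S, ∫ x, ‖cl i x‖ ∂D.ν i ≤ C)
    {I : ι → ℝ} (hI : ∀ i, ∫ x, cl i x * ((χ (RestrictedProduct.mulSingle B i x) : Circle) : ℂ)
      ∂D.ν i = (I i : ℂ)) :
    RCLike.re ⟪θ, θ⟫_ℂ = c * vol * ∏' i, I i :=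
  RallisIP.rallis_field_of_N31e' hvol hN31e hnorm
    (hEuler_of_coeffTensor B D hD ω φ χ hχ hc hfm hcl hχl hB hI)

end N31

end HodgeCM.PerL34.PureTensor

end
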